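import Summits.QuantumFields.BalabanUV.T4Continuum.Support.NE3RightInverseLetters
import Summits.QuantumFields.BalabanUV.T4Continuum.Support.NE7CriticalMultiplier
import HarnessLib

/-!
# NE7MultiplierOfRightInverse — (L5) DISCHARGED: THE LAGRANGE MULTIPLIER OF A CONFIGURATION CRITICAL ON `ker levelQ'` IS `O(a·M^{d−2})` IN THE
# VOLUME-WEIGHTED ℓ¹ CURRENCY, with row NE3's EXACT CURVED RIGHT INVERSE `rightInvW` AS THE PREIMAGE — `|Λ γ| ≤ a·(curl1C∕(1−θℓ))·M^{d−2}·‖γ‖_{ℓ¹(periodBox N)}`,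
# k-FREE, N-FREE (`M = L^{k+1}`, `a` the plaquette radius of `U`; at `a = εM⁻²`, `d = 4`: `|Λ γ| ≤ ε·c₃·‖γ‖_ℓ¹`)

Cell `pub-balaban`, rung (B)+1 sub-cell t4, lineage `b2b-balaban-t4-ne7-p1`, generation 69 (CRUX PROVER NE7 #1); hunt (h13), memo
`t4/b2b-balaban-t4-ne7-p1-g69/HUNT-H13-ROUTE-PI-TRANSPOSED.md` §3.  File F32 (over F8 `NE7CriticalMultiplier.abs_multiplier_le` and row NE3's route-Π kernel
`NE3SmoothRightInverseW.rightInvW` ∕ `NE3RightInverseLetters.sum_norm_curl_rightInvW_le` (R3)).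

WHY.  Memo H10 §3bis (L5) ∕ H11 §2(ii) ∕ H12 §3: the a-priori estimate (APE) and the constrained-Hessian multiplier term both need the multiplier's size
with a SMOOTH preimage — F8's `abs_multiplier_le` bounds `|Λ γ|` by `a·Σ‖curl_U(preimage of γ)‖` for ANY preimage, and the sheet preimage
(`SpreadLift`) loses a factor `M`.  Row NE3's `rightInvW` is the smooth preimage: its (R3) letter `Σ_{perWin}‖curl_W(rightInvW φ)‖ ≤ c₃·M^{d−2}·dirL1 φ`
(`c₃ = curl1C d L∕(1 − thetaLoc d L·ε)`) is exactly memo H11 §2(c)'s `2Σ_B M^{d−2}γ_B`.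
WHAT ([folklore]; 0 def, 0 sorry).
§1 **`coe_levelQ'_resDir`** — THE DICTIONARY `levelQ' ↔ dirIter` AS AN EQUATION (row NE3-R2's `levelQ'_resDir_eq_zero` proves the kernel inclusion only):
   in the multi-level small-field class at `W₁` (period `L·tower L M′ j`), for every `(L·tower L M′ j)`-periodic direction `φ`,
   `(levelQ' L M′ j W₁ (resDir φ) : TDir) = skewPF M′ (resDir M′ (dirIter L (j+1) W₁ φ))` (induction through the tower with
   `fderiv_coord_resDir`).
§2 **`levelQ'_resDir_rightInvW`** — the right inverse IS a preimage in F8's currency: `levelQ' L N k W (resDir (rightInvW … (extDir N γ))) = γ` for every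
   `γ ∈ skewSub d n N`.
§3 **`abs_multiplier_le_rightInvW`** — at the base `W` with the finer radius `SmallField W a` and a linear `Λ` with F8's multiplier property AT `W` (class
   data as for `rightInvW`, W6 regime `thetaLoc·ε < 1`, `ε = M²x ≤ 1`): `|Λ γ| ≤ a·(curl1C d L∕(1 − thetaLoc d L·M²x))·(M^d∕M²)·dirL1 (extDir N γ) (periodBox N)`;
   **`abs_multiplier_le_rightInvW_kfree`** — `a = t·x`: `|Λ γ| ≤ t·ε·c₃·(M^d∕M⁴)·‖γ‖_ℓ¹` (every `M` cancels at `d = 4`).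
HONEST FRAMING (page 1).  Linear algebra + bookkeeping over row NE3's landed kernel theorems; nothing about Bałaban's minimisers is asserted; (APE) is NOT
proved (this is one of its displayed inputs); NOT ONE-STEP, NOT NE7; spine 0∕9; finite T⁴ rung (B)+1 — NOT infinite volume, NOT mass gap, NOT Clay.
Continuum YM on T⁴ ⇐ BetaPertH ∧ nine spine estimates (0/9 proved); BetaPertH ⇐ (D1) ∧ (D4) ∧ CAP+tail; G-an2-4 gates asym, D1 and NE2/3/4.
-/

set_option autoImplicit false

open scoped BigOperators Matrix Matrix.Norms.L2Operator
open NormedSpace Finset Set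

namespace Summit.QuantumFields.BalabanUV.T4Continuum.NE7MultiplierOfRightInverse

open Literature.MathematicalPhysics.QuantumFieldTheory.Balaban1983to89
open B7Prop1Explicit B7Prop2Explicit
open T4AveragingDeficitWall (IsUnitaryCfg IsSkewDir SmallField curl dirL1)
open T4AveragingDeficitWallBoundary (IsPeriodicCfg periodBox)
open AveragingDeficitPeriodicCounting (IsPeriodicDir)
open AveragingDeficitTorusChart (TDir extDir resDir extDir_resDir resDir_extDir isPeriodicDir_extDir)
open AveragingDeficitChartCalculus (cavg coord)
open AveragingDeficitTwoLevelPrep (skewSub skewPF skewPF_of_mem twoLevelSmall)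
open AveragingDeficitMultiLevelPrep (tower levelQ' LevelSmall cpush natCast_tower_succ fderiv_coord_resDir ball_of_small isPeriodicDir_cpush)
open AveragingDeficitFermat (isPeriodicCfg_cavg)
open MinimalActionLevels (perWin)
open NE3HessForm (dAction)
open NE3TangentCovariantTower (dirIter step_small)
open NE3QbarIterCovLiftPrep (cruxC)
open NE3SmoothRightInverseW (rightInvW isSkewDir_rightInvW isPeriodicDir_rightInvW dirIter_rightInvW)
open NE3RightInverseSolveLetters (thetaLoc)
open NE3HatInvCurlLetters (curl1C curl1C_nonneg)
open NE3RightInverseLetters (sum_norm_curl_rightInvW_le)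
open NE7CriticalMultiplier (abs_multiplier_le)

noncomputable section

variable {d : ℕ} {n : Type*} [Fintype n] [DecidableEq n]

/-! ## §1 The dictionary `levelQ' ↔ dirIter` as an equation -/

/-- **`levelQ'` IS THE `𝔲(N)` PART OF THE TORUS READING OF `dirIter`**: in the multi-level small-field class at the base `W₁` (unitary, period
`L·tower L M′ j`, `SmallField W₁ x`, `LevelSmall d L j x`), for every `(L·tower L M′ j)`-periodic direction `φ` of `ℤ^d`,
`(levelQ' L M′ j W₁ (resDir φ) : TDir d n M′) = skewPF M′ (resDir M′ (dirIter L (j+1) W₁ φ))`. [folklore] -/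
theorem coe_levelQ'_resDir [Nonempty n] {L M' : ℕ} [NeZero L] [NeZero M'] (hL : 1 ≤ L) (j : ℕ) :
    ∀ {W₁ : Site d → Fin d → (Matrix n n ℂ)ˣ} {x : ℝ}, IsUnitaryCfg W₁ → IsPeriodicCfg W₁ ((L : ℤ) * (tower L M' j : ℕ)) →
    0 ≤ x → LevelSmall d L j x → SmallField W₁ x → ∀ {φ : Site d → Fin d → (Matrix n n ℂ)},
    IsPeriodicDir φ ((L * tower L M' j : ℕ) : ℤ) →
      ((levelQ' L M' j W₁ (resDir (L * tower L M' j) φ) : ↥(skewSub d n M')) : TDir d n M')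
        = skewPF M' (resDir M' (dirIter L (j + 1) W₁ φ)) := by
  induction j with
  | zero =>
      intro W₁ x hW₁ _ hx hs hW₁x φ hφP
      have hφP0 : IsPeriodicDir φ ((L * M' : ℕ) : ℤ) := hφP
      have hval : ((levelQ' L M' 0 W₁ (resDir (L * tower L M' 0) φ) : ↥(skewSub d n M')) : TDir d n M')
          = skewPF M' ((fderiv ℝ (coord (ContinuousLinearMap.id ℝ (Matrix n n ℂ)) L M' W₁) 0) (resDir (L * M') φ)) := rfl
      rw [hval, fderiv_coord_resDir (N := M') (ball_of_small hL hW₁ hx hs hW₁x) hφP0]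
      rfl
  | succ j ih =>
      intro W₁ x hW₁ hW₁P hx hs hW₁x φ hφP
      obtain ⟨_, hcu, hr0, hcx⟩ := step_small hL hW₁ hx hs.1 hW₁x
      have hφP' : IsPeriodicDir φ ((L : ℤ) * (L * tower L M' j : ℕ)) := by
        have e : ((L * tower L M' (j + 1) : ℕ) : ℤ) = (L : ℤ) * (L * tower L M' j : ℕ) := by
          simp only [tower]; push_cast; ring
        rw [e] at hφP; exact hφP
      have hW₁P' : IsPeriodicCfg (cavg L W₁) ((L : ℤ) * (tower L M' j : ℕ)) := by
        have h := isPeriodicCfg_cavg L (tower L M' (j + 1)) hW₁P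
        rw [natCast_tower_succ] at h
        exact h
      have hval : ((levelQ' L M' (j + 1) W₁ (resDir (L * tower L M' (j + 1)) φ) : ↥(skewSub d n M')) : TDir d n M')
          = (((levelQ' L M' j (cavg L W₁)).comp (fderiv ℝ (coord (ContinuousLinearMap.id ℝ (Matrix n n ℂ)) L (L * tower L M' j) W₁) 0)
              (resDir (L * (L * tower L M' j)) φ) : ↥(skewSub d n M')) : TDir d n M') := rfl
      rw [hval, ContinuousLinearMap.comp_apply, fderiv_coord_resDir (N := L * tower L M' j) (ball_of_small hL hW₁ hx hs.1 hW₁x) hφP]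
      exact ih hcu hW₁P' hr0 hs.2 hcx (isPeriodicDir_cpush L _ hW₁P hφP')

/-! ## §2 The right inverse is a preimage in the `levelQ'` currency -/

omit [Fintype n] [DecidableEq n] in
/-- The coarse field `extDir N γ` of a `𝔲(N)` torus field is skew. [folklore] -/
theorem isSkewDir_extDir_coe {N : ℕ} [NeZero N] (γ : ↥(skewSub d n N)) : IsSkewDir (extDir N (γ : TDir d n N)) := fun _ _ => γ.2 _ _

section RightInv

variable [Nonempty n] {L : ℕ} [NeZero L] (hL : 2 ≤ L) (k : ℕ) {N : ℕ} [NeZero N] {W : Site d → Fin d → (Matrix n n ℂ)ˣ} {x : ℝ}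
  (hWu : IsUnitaryCfg W) (hWP : IsPeriodicCfg W ((tower L N (k + 1) : ℕ) : ℤ)) (hx : 0 ≤ x) (hs : LevelSmall d L k x) (hWx : SmallField W x)
  (hθ : cruxC d L * (((L : ℝ) ^ (k + 1)) ^ 2 * x) < 1) (hθl : thetaLoc d L * (((L : ℝ) ^ (k + 1)) ^ 2 * x) < 1)
  (hε : ((L : ℝ) ^ (k + 1)) ^ 2 * x ≤ 1)

include hWP in
/-- **THE RIGHT INVERSE IS A PREIMAGE**: `levelQ' L N k W (resDir (rightInvW … (extDir N γ))) = γ`. [folklore] -/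
theorem levelQ'_resDir_rightInvW (γ : ↥(skewSub d n N)) :
    levelQ' L N k W (resDir (L * tower L N k) (rightInvW hL k hWu hx hs hWx N hθ (isSkewDir_extDir_coe γ))) = γ := by
  have hL1 : 1 ≤ L := by omega
  have hφP : IsPeriodicDir (extDir N (γ : TDir d n N)) (N : ℤ) := isPeriodicDir_extDir N _
  have hWP' : IsPeriodicCfg W ((L : ℤ) * (tower L N k : ℕ)) := by
    have e : ((tower L N (k + 1) : ℕ) : ℤ) = (L : ℤ) * (tower L N k : ℕ) := natCast_tower_succ L N k
    rw [e] at hWP; exact hWP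
  have hRP : IsPeriodicDir (rightInvW hL k hWu hx hs hWx N hθ (isSkewDir_extDir_coe γ)) ((L * tower L N k : ℕ) : ℤ) :=
    isPeriodicDir_rightInvW hL k hWu hWP hx hs hWx hθ (isSkewDir_extDir_coe γ)
  apply Subtype.ext
  rw [coe_levelQ'_resDir hL1 k hWu hWP' hx hs hWx hRP, dirIter_rightInvW hL k hWu hWP hx hs hWx hθ (isSkewDir_extDir_coe γ) hφP,
    resDir_extDir]
  exact skewPF_of_mem γ.2

/-! ## §3 The multiplier bound with the smooth preimage -/

include hL hWu hWP hx hs hWx hθ hθl hε in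
/-- **(L5) — THE MULTIPLIER IS `O(a·M^{d−2})` IN VOLUME-WEIGHTED ℓ¹**: let the base `W` (class data as for `rightInvW`, W6 regime) carry the finer
plaquette radius `SmallField W a` (`0 ≤ a`; for an interior constrained critical configuration `a = δM⁻²`), and let a linear `Λ` have F8's multiplier
property AT `W` on the period window (`dAction W (extDir Φ) (perWin d (N·L^{k+1})) = Λ (levelQ' L N k W Φ)` on skew torus fields — F8's
`exists_multiplier` for a configuration critical on `ker levelQ'`).  Then every `γ ∈ skewSub d n N` obeys
`|Λ γ| ≤ a·(curl1C d L∕(1 − thetaLoc d L·(M²x)))·(M^d∕M²)·dirL1 (extDir N γ) (periodBox N)`, `M = L^{k+1}` — k-FREE, N-FREE. [folklore] -/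
theorem abs_multiplier_le_rightInvW {a : ℝ} (ha : 0 ≤ a) (hWa : SmallField W a) {Λ : ↥(skewSub d n N) →ₗ[ℝ] ℝ}
    (hΛ : ∀ Φ : TDir d n (L * tower L N k), (∀ r κ, Φ r κ ∈ skewAdjoint (Matrix n n ℂ)) →
      dAction W (extDir (L * tower L N k) Φ) (perWin d (N * L ^ (k + 1))) = Λ (levelQ' L N k W Φ))
    (γ : ↥(skewSub d n N)) :
    |Λ γ| ≤ a * ((curl1C d L / (1 - thetaLoc d L * (((L : ℝ) ^ (k + 1)) ^ 2 * x))) * (((L : ℝ) ^ (k + 1)) ^ d / ((L : ℝ) ^ (k + 1)) ^ 2)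
      * dirL1 (extDir N (γ : TDir d n N)) (periodBox (d := d) N)) := by
  set R := rightInvW hL k hWu hx hs hWx N hθ (isSkewDir_extDir_coe γ) with hR
  have hRs : IsSkewDir R := isSkewDir_rightInvW hL k hWu hx hs hWx hθ (isSkewDir_extDir_coe γ)
  have hRP : IsPeriodicDir R ((L * tower L N k : ℕ) : ℤ) := isPeriodicDir_rightInvW hL k hWu hWP hx hs hWx hθ (isSkewDir_extDir_coe γ)
  have hΦ : ∀ r κ, resDir (L * tower L N k) R r κ ∈ skewAdjoint (Matrix n n ℂ) := fun r κ => hRs _ _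
  have h1 := abs_multiplier_le (V := W) k hWu hWa (perWin d (N * L ^ (k + 1))) hΛ hΦ (levelQ'_resDir_rightInvW hL k hWu hWP hx hs hWx hθ γ)
  rw [extDir_resDir (L * tower L N k) hRP] at h1
  have h2 := sum_norm_curl_rightInvW_le (N := N) hL k hWu hWP hx hs hWx hθ hθl hε (isSkewDir_extDir_coe γ)
  exact h1.trans (mul_le_mul_of_nonneg_left h2 ha)

include hL hWu hWP hx hs hWx hθ hθl hε in
/-- **(L5) AT THE CLASS RADIUS, k-FREE FORM**: with `a := εM⁻²·t` — any multiple `t ≥ 0` of the class radius `ε∕M²`, `ε := M²x` — the bound reads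
`|Λ γ| ≤ t·ε·(curl1C d L∕(1 − thetaLoc d L·ε))·(M^d∕M⁴)·‖γ‖_{ℓ¹(periodBox N)}`; at `d = 4` every `M` cancels. [folklore] -/
theorem abs_multiplier_le_rightInvW_kfree {t : ℝ} (ht : 0 ≤ t) (hWa : SmallField W (t * x)) {Λ : ↥(skewSub d n N) →ₗ[ℝ] ℝ}
    (hΛ : ∀ Φ : TDir d n (L * tower L N k), (∀ r κ, Φ r κ ∈ skewAdjoint (Matrix n n ℂ)) →
      dAction W (extDir (L * tower L N k) Φ) (perWin d (N * L ^ (k + 1))) = Λ (levelQ' L N k W Φ))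
    (γ : ↥(skewSub d n N)) :
    |Λ γ| ≤ t * (((L : ℝ) ^ (k + 1)) ^ 2 * x) * (curl1C d L / (1 - thetaLoc d L * (((L : ℝ) ^ (k + 1)) ^ 2 * x)))
      * (((L : ℝ) ^ (k + 1)) ^ d / ((L : ℝ) ^ (k + 1)) ^ 4) * dirL1 (extDir N (γ : TDir d n N)) (periodBox (d := d) N) := by
  have hM0 : (0 : ℝ) < (L : ℝ) ^ (k + 1) := by
    have : (0 : ℝ) < L := by exact_mod_cast (show 0 < L by omega)
    positivity
  have h := abs_multiplier_le_rightInvW hL k hWu hWP hx hs hWx hθ hθl hε (mul_nonneg ht hx) hWa hΛ γ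
  refine h.trans (le_of_eq ?_)
  field_simp

end RightInv

end

end Summit.QuantumFields.BalabanUV.T4Continuum.NE7MultiplierOfRightInverse
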